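import Literature.Probability.LatticeModels.FermionicObservableSums
import HarnessLib

/-!
# The discrete primitive `H = Im ∫ F²` of an s-holomorphic function: local identities

Topic `Literature/Probability/LatticeModels`; node 2 (local part) of the discharge programme for
crit-ising.S18 / Smirnov's Theorem 2.2 (`Sweep1Proofs.lean`, module docstring §2), i.e. the
lattice algebra of S. Smirnov, *Conformal invariance in random cluster models. I*, Ann. of Math.
172 (2010), **§3.3: Lemma 3.6, Remark 3.7, Lemma 3.8** (with the computation of Appendix C),
transcribed to the tree's square-lattice conventions (`IsSHolomorphic`, `cornerLine`, `projLine`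
of `FermionicObservable.lean`; coded corners `(v, k)`, `cSrc`, `cTgt`, `cFace`, `faceAt`,
`cornerUnit` of `MedialInterfaceProofs.lean`).

Dictionary. Smirnov's §3 lattice is the *medial* lattice of `δℤ²` (§4): its vertices are the
medial vertices `MedialVertex` (edges of `ℤ²`), its edges are the corners `(v, k)` (from
`cSrc (v, k)`, the `k`-th edge `e_k` at `v`, to `cTgt (v, k) = e_{k+1}`, inside the face
`cFace (v, k) = faceAt v k`), and its squares are of two kinds: the vertices `v` of `ℤ²` and the
faces `f` of `ℤ²`. A corner is oriented with its vertex on the left (`cornerSource`,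
`cornerTarget`), and `cornerLine v f = (i (w_c - u_c))^{-1/2}` spans Smirnov's line
`ℓ(e) ∋ √(conj e⃗)` for this orientation, so in Smirnov's colouring ("white on the left, black on
the right") the **vertices of `ℤ²` are the white squares and the faces of `ℤ²` are the black
squares**. For an s-holomorphic `F` the increment of `H` across the corner `c = (v, k)` is
`H(black) - H(white) = H(faceAt v k) - H(v) = |Proj[F ; ℓ(c)]|² =: cornerFlux F (v, k)`
(Lemma 3.6).

Contents (everything PROVED; no named facts, two auxiliary definitions `frameVec`, `frameCoord`
and the two notions `cornerFlux`, `IsSHolAt`):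

* the frame computation behind all of §3.3: every corner line `ℓ(v, k)` is a nonzero real
  multiple of `η₀ (1 - i)ⁿ`, `n ≡ k (mod 4)`, for the reference vector
  `η₀ = frameVec v₀ = cornerLine v₀ (faceAt v₀ 0)` (`cornerLine_eq_frame`, from `cornerLine_sq'`;
  "with each step the line is rotated by `π/4`"), whence, with `frameCoord v₀ X = X conj(η₀)`,
  `‖Proj[X ; ℓ(v,k)]‖² = Re(frameCoord X · (1+i)ⁿ)² / (√2 · 2ⁿ)` (`norm_projLine_cornerLine_sq`)
  and the projection identities of `IsSHolomorphic` become real-linear equations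
  (`projLine_cornerLine_eq_iff`);
* `cornerFlux F q`, `IsSHolAt F q` (s-holomorphicity across one coded corner, extracted from
  `IsSHolomorphic` by `IsSHolomorphic.isSHolAt`);
* Pythagoras for the orthogonal lines of opposite corners (`norm_projLine_sq_add_two`) and
  **Lemma 3.6** in its local form: the signed fluxes around every medial vertex add up to zero
  (`cornerFlux_cycle`), which is what makes `H` well defined on simply connected lattice domains;
* **Remark 3.7** ("`2δ (H(v) - H(u)) = Im (F(z)² (v - u))`") in the tree's normalisation:
  `H(u + e_k) - H(u) = -Im(i^k F(e_k)²)/√2` (`cornerFlux_sub_cornerFlux_eq_im`);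
* **Lemma 3.8**: the Laplacian of `H` restricted to the white squares (vertices `u` of `ℤ²`, four
  diagonal neighbours `u + e_k`) is `-‖F(e₀) - F(e₂)‖² ≤ 0` (`sum_vertexStep_eq_neg_norm_sq`:
  `H^w` is superharmonic), and restricted to the black squares (faces `f`, four edge-adjacent
  faces) it is `+‖F(E₀) - F(E₂)‖² ≥ 0` (`sum_faceStep_eq_norm_sq`: `H^b` is subharmonic), for `F`
  s-holomorphic at the eight corners involved.

NOT here: the global primitive `H` itself (a function on vertices and faces with these
increments exists on simply connected lattice domains — a discrete Poincaré lemma, i.e. the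
topology of `meshDomain`), the boundary statements Lemma 3.10 / Lemma 4.11, and all of §5.
-/

noncomputable section

namespace Literature.Probability.LatticeModels

open Complex ComplexConjugate

/-! ### Real multiples, projections onto a line -/

/-- If `a² = c b²` for a real `c > 0` then `a` is a nonzero real multiple of `b` (`a = ±√c b`). [folklore] -/
theorem exists_real_mul_of_sq_eq {a b : ℂ} {c : ℝ} (hc : 0 < c) (h : a ^ 2 = (c : ℂ) * b ^ 2) :
    ∃ t : ℝ, t ≠ 0 ∧ a = t * b := by
  have hs : ((Real.sqrt c : ℝ) : ℂ) ^ 2 = c := by rw [← ofReal_pow, Real.sq_sqrt hc.le]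
  have h' : a ^ 2 = ((Real.sqrt c : ℂ) * b) ^ 2 := by rw [mul_pow, hs, h]
  have hne : Real.sqrt c ≠ 0 := (Real.sqrt_pos.2 hc).ne'
  rcases sq_eq_sq_iff_eq_or_eq_neg.1 h' with h1 | h1
  · exact ⟨Real.sqrt c, hne, h1⟩
  · exact ⟨-Real.sqrt c, neg_ne_zero.2 hne, by rw [h1]; push_cast; ring⟩

/-- The squared length of the projection onto the line `w ℝ` (`w ≠ 0`):
`‖Proj[X ; w]‖² = Re(X w̄)² / ‖w‖²`. (Chelkak–Smirnov 2012, §3.2; from `projLine_eq`.) [folklore] -/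
theorem norm_projLine_sq {w : ℂ} (hw : w ≠ 0) (X : ℂ) :
    ‖projLine w X‖ ^ 2 = (X * conj w).re ^ 2 / ‖w‖ ^ 2 := by
  rw [projLine_eq, norm_smul, Real.norm_eq_abs, mul_pow, sq_abs, div_pow]
  have h : ‖w‖ ≠ 0 := norm_ne_zero_iff.2 hw
  field_simp

/-- Two vectors have the same projection onto the line `w ℝ` (`w ≠ 0`) iff `Re(X w̄) = Re(Y w̄)`. [folklore] -/
theorem projLine_eq_projLine_iff {w : ℂ} (hw : w ≠ 0) (X Y : ℂ) :
    projLine w X = projLine w Y ↔ (X * conj w).re = (Y * conj w).re := by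
  rw [projLine_eq, projLine_eq]
  have hw2 : ‖w‖ ^ 2 ≠ 0 := pow_ne_zero _ (norm_ne_zero_iff.2 hw)
  constructor
  · intro h
    exact (div_left_inj' hw2).1 (smul_left_injective ℝ hw h)
  · intro h
    rw [h]

/-! ### Small identities in `ℂ` -/

/-- `(1 - i)² = 2 (-i)`. [folklore] -/
theorem one_sub_I_sq : (1 - I) ^ 2 = 2 * (-I) := by
  rw [sub_sq, one_pow, mul_one, I_sq]; ring

/-- `(1 + i)² = 2 i`. [folklore] -/
theorem one_add_I_sq : (1 + I) ^ 2 = 2 * I := by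
  rw [add_sq, one_pow, mul_one, I_sq]; ring

/-- `(1 + i)³ = -2 + 2 i`. [folklore] -/
theorem one_add_I_pow_three : (1 + I) ^ 3 = -2 + 2 * I := by
  rw [pow_succ, one_add_I_sq]
  ring_nf
  rw [I_sq]
  ring

/-- `(-i)ⁿ` depends only on `n mod 4`. [folklore] -/
theorem negI_pow_eq_pow_mod (n : ℕ) : (-I) ^ n = (-I) ^ (n % 4) := by
  conv_lhs => rw [← Nat.div_add_mod n 4, pow_add, pow_mul]
  rw [show (-I) ^ 4 = 1 by rw [neg_pow, I_pow_four]; norm_num, one_pow, one_mul]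

/-- Real parts of `z (1 + i)ⁿ` for `n = 0, 1, 2, 3`. [folklore] -/
theorem re_mul_one_add_I_pow (z : ℂ) :
    (z * (1 + I) ^ 0).re = z.re ∧ (z * (1 + I) ^ 1).re = z.re - z.im ∧
      (z * (1 + I) ^ 2).re = -2 * z.im ∧ (z * (1 + I) ^ 3).re = -2 * z.re - 2 * z.im := by
  refine ⟨by simp, by simp, ?_, ?_⟩
  · rw [one_add_I_sq]; simp; ring
  · rw [one_add_I_pow_three]; simp; ring

/-- Splitting a power of `1 + i` off a frame coordinate. [folklore] -/
theorem coord_pow_add (c : ℂ) (n m : ℕ) : c * (1 + I) ^ (n + m) = c * (1 + I) ^ n * (1 + I) ^ m := by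
  rw [pow_add, mul_assoc]

/-! ### The corner lines as real multiples of one frame -/

/-- The **reference vector** of the frame at `v₀`: the line vector of the corner `(v₀, 0)`. [cite: Smirnov2010, Def. 3.1] -/
def frameVec (v₀ : Site 2) : ℂ := cornerLine v₀ (faceAt v₀ 0)

/-- The **frame coordinate** of `X`: `X conj(η₀)`, `η₀ = frameVec v₀`. [folklore] -/
def frameCoord (v₀ : Site 2) (X : ℂ) : ℂ := X * conj (frameVec v₀)

/-- `η₀² = -1 - i` (`cornerLine_sq'` at the corner `(v₀, 0)`). [cite: Smirnov2010, Def. 3.1] -/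
theorem frameVec_sq (v₀ : Site 2) : frameVec v₀ ^ 2 = -1 - I := by
  have h : cornerLine v₀ (faceAt v₀ 0) ^ 2 = (-1 - I) * (-I) ^ ((0 : Fin 4) : ℕ) :=
    cornerLine_sq' (v₀, 0)
  rw [frameVec, h]
  simp

/-- `η₀ ≠ 0`. [folklore] -/
theorem frameVec_ne_zero (v₀ : Site 2) : frameVec v₀ ≠ 0 := by
  intro h
  have h1 := frameVec_sq v₀
  rw [h, sq, zero_mul] at h1
  have := congrArg re h1
  simp at this

/-- `‖η₀‖² = √2`. [folklore] -/
theorem norm_frameVec_sq (v₀ : Site 2) : ‖frameVec v₀‖ ^ 2 = Real.sqrt 2 := by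
  rw [← norm_pow, frameVec_sq, Complex.norm_def, normSq_apply]
  norm_num

/-- The frame coordinate is additive. [folklore] -/
theorem frameCoord_sub (v₀ : Site 2) (X Y : ℂ) :
    frameCoord v₀ (X - Y) = frameCoord v₀ X - frameCoord v₀ Y :=
  sub_mul _ _ _

/-- `‖frameCoord X‖² = √2 ‖X‖²`. [folklore] -/
theorem norm_frameCoord_sq (v₀ : Site 2) (X : ℂ) : ‖frameCoord v₀ X‖ ^ 2 = ‖X‖ ^ 2 * Real.sqrt 2 := by
  rw [frameCoord, norm_mul, mul_pow, Complex.norm_conj, norm_frameVec_sq]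

/-- `‖frameCoord X · (1 + i)ⁿ‖² = √2 · 2ⁿ ‖X‖²`. [folklore] -/
theorem norm_frameCoord_mul_pow_sq (v₀ : Site 2) (X : ℂ) (n : ℕ) :
    ‖frameCoord v₀ X * (1 + I) ^ n‖ ^ 2 = ‖X‖ ^ 2 * Real.sqrt 2 * 2 ^ n := by
  rw [norm_mul, mul_pow, norm_frameCoord_sq, norm_pow, ← pow_mul, mul_comm n 2, pow_mul,
    Complex.sq_norm (1 + I)]
  norm_num [normSq_apply]

/-- The corner lines do not vanish: `cornerLine v (faceAt v k)² = (-1 - i)(-i)^k ≠ 0`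
(`cornerLine_sq'`). [cite: Smirnov2010, Def. 3.1] -/
theorem cornerLine_faceAt_ne_zero (v : Site 2) (k : Fin 4) : cornerLine v (faceAt v k) ≠ 0 := by
  intro h
  have h1 : cornerLine v (faceAt v k) ^ 2 = (-1 - I) * (-I) ^ (k : ℕ) := cornerLine_sq' (v, k)
  rw [h, sq, zero_mul] at h1
  refine absurd h1.symm (mul_ne_zero ?_ (pow_ne_zero _ (neg_ne_zero.2 I_ne_zero)))
  intro h'
  have := congrArg re h'
  simp at this

/-- **All corner lines in one frame.** The square of the line vector of the corner `(v, k)` is a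
positive real multiple of the square of `η₀ (1 - i)ⁿ` whenever `n ≡ k (mod 4)`: both squares are
computed by `cornerLine_sq'` (`(-1 - i)(-i)^k` and `(-1 - i)(2(-i))ⁿ`). (Smirnov 2010, §3: "with
each step the line is rotated by `π/4`".) [cite: Smirnov2010, §3 (before Def. 3.1)] -/
theorem cornerLine_sq_eq_frame (v₀ v : Site 2) (k : Fin 4) {n : ℕ} (hn : n % 4 = (k : ℕ)) :
    cornerLine v (faceAt v k) ^ 2 =
      ((((2 : ℝ) ^ n)⁻¹ : ℝ) : ℂ) * (frameVec v₀ * (1 - I) ^ n) ^ 2 := by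
  have h1 : cornerLine v (faceAt v k) ^ 2 = (-1 - I) * (-I) ^ (k : ℕ) := cornerLine_sq' (v, k)
  rw [h1, mul_pow, frameVec_sq, ← pow_mul, mul_comm n 2, pow_mul, one_sub_I_sq, mul_pow,
    negI_pow_eq_pow_mod n, hn]
  push_cast
  have h2 : (2 : ℂ) ^ n ≠ 0 := pow_ne_zero _ two_ne_zero
  field_simp

/-- Consequently the line vector of the corner `(v, k)` is a nonzero *real* multiple of
`η₀ (1 - i)ⁿ`, `n ≡ k (mod 4)`: the corner lines are the reference line turned clockwise by `k`
eighth-turns. [cite: Smirnov2010, §3 (before Def. 3.1)] -/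
theorem cornerLine_eq_frame (v₀ v : Site 2) (k : Fin 4) {n : ℕ} (hn : n % 4 = (k : ℕ)) :
    ∃ t : ℝ, t ≠ 0 ∧ cornerLine v (faceAt v k) = t * (frameVec v₀ * (1 - I) ^ n) :=
  exists_real_mul_of_sq_eq (by positivity) (cornerLine_sq_eq_frame v₀ v k hn)

/-- The frame vectors do not vanish. [folklore] -/
theorem frameVec_mul_pow_ne_zero (v₀ : Site 2) (n : ℕ) : frameVec v₀ * (1 - I) ^ n ≠ 0 := by
  refine mul_ne_zero (frameVec_ne_zero v₀) (pow_ne_zero _ ?_)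
  intro h
  have := congrArg re h
  simp at this

/-- Conjugate of a frame vector: `conj (η₀ (1 - i)ⁿ) = conj η₀ · (1 + i)ⁿ`. [folklore] -/
theorem conj_frameVec_mul_pow (v₀ : Site 2) (n : ℕ) :
    conj (frameVec v₀ * (1 - I) ^ n) = conj (frameVec v₀) * (1 + I) ^ n := by
  rw [map_mul, map_pow, map_sub, map_one, conj_I, sub_neg_eq_add]

/-- Squared norm of a frame vector: `‖η₀ (1 - i)ⁿ‖² = √2 · 2ⁿ`. [folklore] -/
theorem norm_frameVec_mul_pow_sq (v₀ : Site 2) (n : ℕ) :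
    ‖frameVec v₀ * (1 - I) ^ n‖ ^ 2 = Real.sqrt 2 * 2 ^ n := by
  rw [norm_mul, mul_pow, norm_frameVec_sq, norm_pow, ← pow_mul, mul_comm n 2, pow_mul,
    Complex.sq_norm (1 - I)]
  norm_num [normSq_apply]

/-- **The projections onto the corner lines, in the frame.** For `n ≡ k (mod 4)`,
`‖Proj[X ; ℓ(v, k)]‖² = Re(frameCoord X · (1 + i)ⁿ)² / (√2 · 2ⁿ)`. [cite: Smirnov2010, §3 eq. (3.1)] -/
theorem norm_projLine_cornerLine_sq (v₀ v : Site 2) (k : Fin 4) {n : ℕ} (hn : n % 4 = (k : ℕ))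
    (X : ℂ) :
    ‖projLine (cornerLine v (faceAt v k)) X‖ ^ 2 =
      (frameCoord v₀ X * (1 + I) ^ n).re ^ 2 / (Real.sqrt 2 * 2 ^ n) := by
  obtain ⟨t, ht, h⟩ := cornerLine_eq_frame v₀ v k hn
  rw [h, projLine_real_mul ht, norm_projLine_sq (frameVec_mul_pow_ne_zero v₀ n),
    conj_frameVec_mul_pow, norm_frameVec_mul_pow_sq, ← mul_assoc]
  rfl

/-- **The projection identities, in the frame.** For `n ≡ k (mod 4)`, two vectors have the same
projection onto `ℓ(v, k)` iff `Re(frameCoord X · (1 + i)ⁿ) = Re(frameCoord Y · (1 + i)ⁿ)`: the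
identities of `IsSHolomorphic` are real-linear equations. [cite: Smirnov2010, Def. 3.1] -/
theorem projLine_cornerLine_eq_iff (v₀ v : Site 2) (k : Fin 4) {n : ℕ} (hn : n % 4 = (k : ℕ))
    (X Y : ℂ) :
    projLine (cornerLine v (faceAt v k)) X = projLine (cornerLine v (faceAt v k)) Y ↔
      (frameCoord v₀ X * (1 + I) ^ n).re = (frameCoord v₀ Y * (1 + I) ^ n).re := by
  obtain ⟨t, ht, h⟩ := cornerLine_eq_frame v₀ v k hn
  rw [h, projLine_real_mul ht, projLine_real_mul ht,
    projLine_eq_projLine_iff (frameVec_mul_pow_ne_zero v₀ n), conj_frameVec_mul_pow, ← mul_assoc,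
    ← mul_assoc]
  rfl

/-- Index bookkeeping: `n ≡ k (mod 4)` implies `n + j ≡ k + j (mod 4)` for `j : Fin 4`. [folklore] -/
theorem frame_index {n : ℕ} {k : Fin 4} (hn : n % 4 = (k : ℕ)) (j : Fin 4) :
    (n + (j : ℕ)) % 4 = ((k + j : Fin 4) : ℕ) := by
  rw [Fin.val_add, Nat.add_mod, hn, Nat.mod_eq_of_lt j.isLt]

/-- **Pythagoras for opposite corners.** The lines of the corners `(v, k)` and `(v', k + 2)` are
orthogonal (two eighth-turns apart), so the squared projections of any vector onto them add up to
its squared length — the computation in the proof of Lemma 3.6 ("`ℓ(E) ⊥ ℓ(W)`, `ℓ(N) ⊥ ℓ(S)` … by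
Pythagoras theorem"). [cite: Smirnov2010, proof of Lemma 3.6] -/
theorem norm_projLine_sq_add_two (v v' : Site 2) (k : Fin 4) (X : ℂ) :
    ‖projLine (cornerLine v (faceAt v k)) X‖ ^ 2 +
        ‖projLine (cornerLine v' (faceAt v' (k + 2))) X‖ ^ 2 = ‖X‖ ^ 2 := by
  have hn : (k : ℕ) % 4 = (k : ℕ) := Nat.mod_eq_of_lt k.isLt
  have hn2 : ((k : ℕ) + 2) % 4 = ((k + 2 : Fin 4) : ℕ) := frame_index hn 2
  rw [norm_projLine_cornerLine_sq v v k hn, norm_projLine_cornerLine_sq v v' (k + 2) hn2,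
    coord_pow_add, one_add_I_sq, pow_add (2 : ℝ) (k : ℕ) 2]
  set h := frameCoord v X * (1 + I) ^ (k : ℕ) with hh
  have hs : (Real.sqrt 2 : ℝ) ≠ 0 := (Real.sqrt_pos.2 two_pos).ne'
  have hX : ‖X‖ ^ 2 = ‖h‖ ^ 2 / (Real.sqrt 2 * 2 ^ (k : ℕ)) := by
    rw [hh, norm_frameCoord_mul_pow_sq, eq_div_iff (mul_ne_zero hs (pow_ne_zero _ two_ne_zero))]
    ring
  rw [hX, Complex.sq_norm, normSq_apply]
  have hre : (h * (2 * I)).re = -2 * h.im := by simp; ring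
  rw [hre]
  field_simp

/-! ### Fluxes across corners and s-holomorphicity at a coded corner -/

/-- **Smirnov's increment `|F(c)|²` across the corner `c = (v, k)`**: the squared length of the
projection of `F` at the source edge `cSrc (v, k)` onto the line `ℓ(c)`. For s-holomorphic `F` this
is the increment `H(black) - H(white) = H(faceAt v k) - H(v)` of the discrete primitive
`H = Im ∫ F²` across the medial edge `c` (Lemma 3.6); here it is the primary object,
`H` being obtained from it on simply connected domains. [cite: Smirnov2010, Lemma 3.6] -/
def cornerFlux (F : MedialVertex → ℂ) (q : Site 2 × Fin 4) : ℝ :=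
  ‖projLine (cornerLine q.1 (cFace q)) (F (cSrc q))‖ ^ 2

/-- Fluxes are nonnegative: `H` increases from white to black squares (Remark 3.9). [cite: Smirnov2010, Remark 3.9] -/
theorem cornerFlux_nonneg (F : MedialVertex → ℂ) (q : Site 2 × Fin 4) : 0 ≤ cornerFlux F q :=
  sq_nonneg _

/-- **s-holomorphicity across one coded corner** `q = (v, k)`: the projections of `F (cSrc q)` and
`F (cTgt q)` onto `ℓ(q)` coincide (Def. 3.1, one medial edge at a time; `IsSHolomorphic F dom` is
this for all corners with both ends in `dom`, `IsSHolomorphic.isSHolAt`). [cite: Smirnov2010, Def. 3.1] -/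
def IsSHolAt (F : MedialVertex → ℂ) (q : Site 2 × Fin 4) : Prop :=
  projLine (cornerLine q.1 (cFace q)) (F (cSrc q)) = projLine (cornerLine q.1 (cFace q)) (F (cTgt q))

/-- `IsSHolomorphic F dom` gives `IsSHolAt F q` at every coded corner with both ends in `dom`. [cite: Smirnov2010, Def. 3.1] -/
theorem IsSHolomorphic.isSHolAt {F : MedialVertex → ℂ} {dom : Set MedialVertex}
    (h : IsSHolomorphic F dom) (q : Site 2 × Fin 4) (hs : cSrc q ∈ dom) (ht : cTgt q ∈ dom) :
    IsSHolAt F q := by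
  have h' := h q.1 (cFace q) (isCorner_faceAt q.1 q.2)
  rw [cornerSource_cFace, cornerTarget_cFace] at h'
  exact h' hs ht

/-- Under `IsSHolAt F q` the flux across `q` may be read at the target edge ("we will denote this
common projection by `F(e)`", Def. 3.1). [cite: Smirnov2010, Def. 3.1] -/
theorem IsSHolAt.cornerFlux_eq {F : MedialVertex → ℂ} {q : Site 2 × Fin 4} (h : IsSHolAt F q) :
    cornerFlux F q = ‖projLine (cornerLine q.1 (cFace q)) (F (cTgt q))‖ ^ 2 := by
  unfold cornerFlux
  rw [h]

/-! ### The four corners at a medial vertex; Lemma 3.6 -/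

/-- The corner `(u + e_k, k + 1)` ends at the edge `e_k = cSrc (u, k)`. [folklore] -/
theorem cTgt_add_cornerUnit_succ (u : Site 2) (k : Fin 4) :
    cTgt (u + cornerUnit k, k + 1) = cSrc (u, k) := by
  simp only [cTgt, cSrc]
  rw [show k + 1 + 1 = k + 2 by fin_cases k <;> rfl, cornerUnit_add_two, add_neg_cancel_right,
    Sym2.eq_swap]

/-- The corner `(u + e_k, k + 2)` starts at the edge `e_k = cSrc (u, k)`. [folklore] -/
theorem cSrc_add_cornerUnit_add_two (u : Site 2) (k : Fin 4) :
    cSrc (u + cornerUnit k, k + 2) = cSrc (u, k) := by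
  simp only [cSrc]
  rw [cornerUnit_add_two, add_neg_cancel_right, Sym2.eq_swap]

/-- The corner `(u, k + 3)` ends at the edge `e_k = cSrc (u, k)` (`cTgt_crossPred`, restated for an
explicit pair). [folklore] -/
theorem cTgt_add_three (u : Site 2) (k : Fin 4) : cTgt (u, k + 3) = cSrc (u, k) :=
  cTgt_crossPred (u, k)

/-- **The corners of a face.** The face `f` (lower-left corner `f`) has the corners
`(f + cornerOff j, j)`, `j : Fin 4`, whose source edges `E_j = cSrc (f + cornerOff j, j)` are its
four sides (bottom, right, top, left); the corner `(f + cornerOff j, j)` runs from `E_j` to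
`E_{j+3}` (clockwise around the centre of `f`). Stated with `i = j + 3` as a separate index so that
numerals stay normalised. [folklore] -/
theorem cTgt_face_corner (f : Site 2) {j i : Fin 4} (hi : i = j + 3) :
    cTgt (f + cornerOff j, j) = cSrc (f + cornerOff i, i) := by
  subst hi
  simp only [cTgt, cSrc]
  rw [cornerUnit_succ_eq, cornerUnit_eq_off_sub (j + 3), show j + 3 + 1 = j by fin_cases j <;> rfl,
    show f + cornerOff j + (cornerOff (j + 3) - cornerOff j) = f + cornerOff (j + 3) by abel,
    show f + cornerOff (j + 3) + (cornerOff j - cornerOff (j + 3)) = f + cornerOff j by abel,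
    Sym2.eq_swap]

/-- The face of the corner `(f + cornerOff j, j)` is `f`. [folklore] -/
theorem cFace_face_corner (f : Site 2) (j : Fin 4) : cFace (f + cornerOff j, j) = f := by
  simp [cFace, faceAt]

/-- **Lemma 3.6 (local form): the fluxes are closed around every medial vertex.** The four corners
at the medial vertex `e_k = cSrc (u, k)` are `(u, k)` and `(u + e_k, k + 2)` (leaving `e_k`) and
`(u, k + 3)`, `(u + e_k, k + 1)` (arriving at `e_k`); going around `e_k` through the squares
`u` (white), `faceAt u k` (black), `u + e_k` (white), `faceAt u (k + 3)` (black), the signed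
increments `±|F(c)|²` add up to zero, because opposite corners carry orthogonal lines and both
pairs of squared projections of `F(e_k)` sum to `|F(e_k)|²` (Pythagoras). Hence `H` is well
defined up to a constant on simply connected lattice domains. s-holomorphicity is used at the two
arriving corners only. [cite: Smirnov2010, Lemma 3.6] -/
theorem cornerFlux_cycle (F : MedialVertex → ℂ) (u : Site 2) (k : Fin 4)
    (h₁ : IsSHolAt F (u, k + 3)) (h₂ : IsSHolAt F (u + cornerUnit k, k + 1)) :
    cornerFlux F (u, k) + cornerFlux F (u + cornerUnit k, k + 2) =
      cornerFlux F (u + cornerUnit k, k + 1) + cornerFlux F (u, k + 3) := by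
  rw [h₁.cornerFlux_eq, h₂.cornerFlux_eq]
  simp only [cornerFlux, cFace]
  rw [cTgt_add_three, cTgt_add_cornerUnit_succ, cSrc_add_cornerUnit_add_two,
    norm_projLine_sq_add_two, show k + 3 = k + 1 + 2 by fin_cases k <;> rfl, norm_projLine_sq_add_two]

/-! ### Remark 3.7: the increment of `H` between diagonal neighbours -/

/-- **Remark 3.7 (the increment of `H` across a vertex of the medial lattice).** Across the edge
`e_k` at `u` (from the white square `u` to the white square `u + e_k`, through the black square
`faceAt u k`): `H(u + e_k) - H(u) = |F(u,k)|² - |F(u + e_k, k + 1)|² = -Im(i^k F(e_k)²)/√2` —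
the tree's rendering of "`2δ (H(v) - H(u)) = Im (F(z)² (v - u))`" (Smirnov's `F` and `H` differ
from the tree's by constant normalisations, cf. `Sweep1Proofs`, module docstring §3).
s-holomorphicity is used at the arriving corner `(u + e_k, k + 1)`. [cite: Smirnov2010, Remark 3.7] -/
theorem cornerFlux_sub_cornerFlux_eq_im (F : MedialVertex → ℂ) (u : Site 2) (k : Fin 4)
    (h₂ : IsSHolAt F (u + cornerUnit k, k + 1)) :
    cornerFlux F (u, k) - cornerFlux F (u + cornerUnit k, k + 1) =
      -(I ^ (k : ℕ) * F (cSrc (u, k)) ^ 2).im / Real.sqrt 2 := by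
  rw [h₂.cornerFlux_eq]
  simp only [cornerFlux, cFace]
  rw [cTgt_add_cornerUnit_succ]
  have hn : (k : ℕ) % 4 = (k : ℕ) := Nat.mod_eq_of_lt k.isLt
  have hn1 : ((k : ℕ) + 1) % 4 = ((k + 1 : Fin 4) : ℕ) := frame_index hn 1
  rw [norm_projLine_cornerLine_sq u u k hn, norm_projLine_cornerLine_sq u _ (k + 1) hn1,
    coord_pow_add, pow_one, pow_succ]
  set X := F (cSrc (u, k)) with hX
  set h := frameCoord u X * (1 + I) ^ (k : ℕ) with hh
  -- `(2 · 2^k) i^k X² = h² (-1 - i)`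
  have hsq : (((2 : ℝ) * 2 ^ (k : ℕ) : ℝ) : ℂ) * (I ^ (k : ℕ) * X ^ 2) = h ^ 2 * (-1 - I) := by
    have e1 : h ^ 2 = X ^ 2 * (-1 + I) * (2 ^ (k : ℕ) * I ^ (k : ℕ)) := by
      rw [hh, frameCoord, mul_pow, mul_pow, ← map_pow, frameVec_sq, ← pow_mul, mul_comm (k : ℕ) 2,
        pow_mul, one_add_I_sq, mul_pow, map_sub, map_neg, map_one, conj_I, sub_neg_eq_add]
    rw [e1]
    push_cast
    linear_combination ((2 : ℂ) ^ (k : ℕ) * I ^ (k : ℕ) * X ^ 2) * I_sq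
  have him1 := congrArg Complex.im hsq
  rw [im_ofReal_mul] at him1
  have him2 : (h ^ 2 * (-1 - I)).im = -(2 * h.re * h.im) - (h.re ^ 2 - h.im ^ 2) := by
    simp [sq]; ring
  have hpos : (0 : ℝ) < 2 * 2 ^ (k : ℕ) := by positivity
  have him3 : (I ^ (k : ℕ) * X ^ 2).im = (-(2 * h.re * h.im) - (h.re ^ 2 - h.im ^ 2)) / (2 * 2 ^ (k : ℕ)) := by
    rw [eq_div_iff hpos.ne', mul_comm, him1, him2]
  have hre1 : (h * (1 + I)).re = h.re - h.im := by simp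
  rw [him3, hre1]
  have hs : (Real.sqrt 2 : ℝ) ≠ 0 := (Real.sqrt_pos.2 two_pos).ne'
  field_simp
  ring

/-! ### Lemma 3.8: the Laplacians of `H` on white (vertex) and black (face) squares -/

/-- The polynomial identity behind Lemma 3.8 on white squares (Appendix C): in the frame
coordinates `g_k = x_k + i y_k` of `F(e_k)`, the four projection relations around a vertex imply
that the alternating sum of the eight squared projections is `-‖g₀ - g₂‖²`. [cite: Smirnov2010, Appendix C] -/
theorem appendixC_white_identity (x₀ y₀ x₁ y₁ x₂ y₂ x₃ y₃ : ℝ) (h0 : x₀ = x₁) (h1 : x₁ - y₁ = x₂ - y₂)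
    (h2 : y₂ = y₃) (h3 : x₃ + y₃ = x₀ + y₀) :
    (x₀ ^ 2 - (x₀ - y₀) ^ 2 / 2) + ((x₁ - y₁) ^ 2 / 2 - y₁ ^ 2) + (y₂ ^ 2 - (x₂ + y₂) ^ 2 / 2)
        + ((x₃ + y₃) ^ 2 / 2 - x₃ ^ 2) = -((x₀ - x₂) ^ 2 + (y₀ - y₂) ^ 2) := by
  linear_combination
    (2 * (x₀ - x₂ + y₂) - ((x₀ - x₁) + (x₁ - y₁ - x₂ + y₂))) * h0
    + ((x₂ - y₂) + (x₁ - y₁ - x₂ + y₂) / 2 + 2 * (x₀ - x₂ + y₂) - ((x₀ - x₁) + (x₁ - y₁ - x₂ + y₂))) * h1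
    + (-2 * (x₀ + y₀ - y₂) - ((y₂ - y₃) + (x₃ + y₃ - x₀ - y₀))) * h2
    + ((x₀ + y₀) + (x₃ + y₃ - x₀ - y₀) / 2 - 2 * (x₀ + y₀ - y₂) - ((y₂ - y₃) + (x₃ + y₃ - x₀ - y₀))) * h3

/-- The polynomial identity behind Lemma 3.8 on black squares (Appendix C): in the frame
coordinates of the values at the four sides `E_j` of a face, the four projection relations at the
corners of the face imply that the alternating sum of the eight squared projections is
`+‖g₀ - g₂‖²`. [cite: Smirnov2010, Appendix C] -/
theorem appendixC_black_identity (x₀ y₀ x₁ y₁ x₂ y₂ x₃ y₃ : ℝ) (h0 : x₀ = x₃) (h1 : x₁ - y₁ = x₀ - y₀)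
    (h2 : y₂ = y₁) (h3 : x₃ + y₃ = x₂ + y₂) :
    ((x₀ + y₀) ^ 2 / 2 - x₀ ^ 2) + (x₁ ^ 2 - (x₁ - y₁) ^ 2 / 2) + ((x₂ - y₂) ^ 2 / 2 - y₂ ^ 2)
        + (y₃ ^ 2 - (x₃ + y₃) ^ 2 / 2) = (x₀ - x₂) ^ 2 + (y₀ - y₂) ^ 2 := by
  linear_combination
    (2 * (x₂ + y₂ - x₀) + (x₀ - x₃) + (x₃ + y₃ - x₂ - y₂)) * h0
    + (2 * (x₀ - y₀ + y₂) + (x₁ - y₁ - x₀ + y₀) - (y₂ - y₁) - (x₀ - y₀) - (x₁ - y₁ - x₀ + y₀) / 2) * h1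
    + (-2 * (x₀ - y₀ + y₂) - (x₁ - y₁ - x₀ + y₀) + (y₂ - y₁)) * h2
    + (2 * (x₂ + y₂ - x₀) + (x₀ - x₃) + (x₃ + y₃ - x₂ - y₂) - (x₂ + y₂) - (x₃ + y₃ - x₂ - y₂) / 2) * h3

/-- **Lemma 3.8, white squares (vertices): `H^w` is superharmonic.** At a vertex `u` of `ℤ²` with
edges `e_k = cSrc (u, k)`, the sum over the four diagonal neighbours `u + e_k` of the increments
`H(u + e_k) - H(u) = |F(u, k)|² - |F(u + e_k, k + 1)|²` equals `-‖F(e₀) - F(e₂)‖²` (and also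
`-‖F(e₁) - F(e₃)‖²` by the symmetry `k ↦ k + 1` of the hypotheses); in particular it is `≤ 0`:
`Δ H^w ≤ 0`. Hypotheses: s-holomorphicity at the four corners `(u, k)` around `u`
(Smirnov's relations between `F(NW), F(NE), F(SE), F(SW)`) and at the four arriving corners
`(u + e_k, k + 1)` (to read the outer fluxes at `e_k`). The proof is the computation of
Appendix C in the frame of `cornerLine_eq_frame`: with `g_k = frameCoord u (F(e_k))` the eight
fluxes are `Re(g_k (1+i)^j)²/(√2 · 2^j)` and the four relations are real-linear, after which the
identity is a polynomial identity in the real and imaginary parts. [cite: Smirnov2010, Lemma 3.8 and Appendix C] -/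
theorem sum_vertexStep_eq_neg_norm_sq (F : MedialVertex → ℂ) (u : Site 2)
    (h : ∀ k : Fin 4, IsSHolAt F (u, k)) (h' : ∀ k : Fin 4, IsSHolAt F (u + cornerUnit k, k + 1)) :
    ∑ k : Fin 4, (cornerFlux F (u, k) - cornerFlux F (u + cornerUnit k, k + 1)) =
      -‖F (cSrc (u, 0)) - F (cSrc (u, 2))‖ ^ 2 := by
  obtain ⟨r0, r1, -, r3⟩ := re_mul_one_add_I_pow (frameCoord u (F (cSrc (u, 0))))
  obtain ⟨s0, s1, s2, -⟩ := re_mul_one_add_I_pow (frameCoord u (F (cSrc (u, 1))))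
  obtain ⟨-, t1, t2, t3⟩ := re_mul_one_add_I_pow (frameCoord u (F (cSrc (u, 2))))
  obtain ⟨w0, -, w2, w3⟩ := re_mul_one_add_I_pow (frameCoord u (F (cSrc (u, 3))))
  -- inner fluxes
  have e0 : cornerFlux F (u, 0) = (frameCoord u (F (cSrc (u, 0)))).re ^ 2 / (Real.sqrt 2 * 2 ^ 0) := by
    show ‖projLine (cornerLine u (faceAt u 0)) (F (cSrc (u, 0)))‖ ^ 2 = _
    rw [norm_projLine_cornerLine_sq u u 0 (n := 0) rfl, r0]
  have e1 : cornerFlux F (u, 1) = ((frameCoord u (F (cSrc (u, 1)))).re -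
      (frameCoord u (F (cSrc (u, 1)))).im) ^ 2 / (Real.sqrt 2 * 2 ^ 1) := by
    show ‖projLine (cornerLine u (faceAt u 1)) (F (cSrc (u, 1)))‖ ^ 2 = _
    rw [norm_projLine_cornerLine_sq u u 1 (n := 1) rfl, s1]
  have e2 : cornerFlux F (u, 2) = (-2 * (frameCoord u (F (cSrc (u, 2)))).im) ^ 2 /
      (Real.sqrt 2 * 2 ^ 2) := by
    show ‖projLine (cornerLine u (faceAt u 2)) (F (cSrc (u, 2)))‖ ^ 2 = _
    rw [norm_projLine_cornerLine_sq u u 2 (n := 2) rfl, t2]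
  have e3 : cornerFlux F (u, 3) = (-2 * (frameCoord u (F (cSrc (u, 3)))).re -
      2 * (frameCoord u (F (cSrc (u, 3)))).im) ^ 2 / (Real.sqrt 2 * 2 ^ 3) := by
    show ‖projLine (cornerLine u (faceAt u 3)) (F (cSrc (u, 3)))‖ ^ 2 = _
    rw [norm_projLine_cornerLine_sq u u 3 (n := 3) rfl, w3]
  -- outer fluxes, read at `e_k` through `h'`
  have f0 : cornerFlux F (u + cornerUnit 0, 0 + 1) = ((frameCoord u (F (cSrc (u, 0)))).re -
      (frameCoord u (F (cSrc (u, 0)))).im) ^ 2 / (Real.sqrt 2 * 2 ^ 1) := by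
    rw [(h' 0).cornerFlux_eq, cTgt_add_cornerUnit_succ]
    show ‖projLine (cornerLine (u + cornerUnit 0) (faceAt (u + cornerUnit 0) (0 + 1)))
      (F (cSrc (u, 0)))‖ ^ 2 = _
    rw [norm_projLine_cornerLine_sq u _ (0 + 1) (n := 1) rfl, r1]
  have f1 : cornerFlux F (u + cornerUnit 1, 1 + 1) = (-2 * (frameCoord u (F (cSrc (u, 1)))).im) ^ 2 /
      (Real.sqrt 2 * 2 ^ 2) := by
    rw [(h' 1).cornerFlux_eq, cTgt_add_cornerUnit_succ]
    show ‖projLine (cornerLine (u + cornerUnit 1) (faceAt (u + cornerUnit 1) (1 + 1)))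
      (F (cSrc (u, 1)))‖ ^ 2 = _
    rw [norm_projLine_cornerLine_sq u _ (1 + 1) (n := 2) rfl, s2]
  have f2 : cornerFlux F (u + cornerUnit 2, 2 + 1) = (-2 * (frameCoord u (F (cSrc (u, 2)))).re -
      2 * (frameCoord u (F (cSrc (u, 2)))).im) ^ 2 / (Real.sqrt 2 * 2 ^ 3) := by
    rw [(h' 2).cornerFlux_eq, cTgt_add_cornerUnit_succ]
    show ‖projLine (cornerLine (u + cornerUnit 2) (faceAt (u + cornerUnit 2) (2 + 1)))
      (F (cSrc (u, 2)))‖ ^ 2 = _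
    rw [norm_projLine_cornerLine_sq u _ (2 + 1) (n := 3) rfl, t3]
  have f3 : cornerFlux F (u + cornerUnit 3, 3 + 1) = (frameCoord u (F (cSrc (u, 3)))).re ^ 2 /
      (Real.sqrt 2 * 2 ^ 0) := by
    rw [(h' 3).cornerFlux_eq, cTgt_add_cornerUnit_succ]
    show ‖projLine (cornerLine (u + cornerUnit 3) (faceAt (u + cornerUnit 3) (3 + 1)))
      (F (cSrc (u, 3)))‖ ^ 2 = _
    rw [norm_projLine_cornerLine_sq u _ (3 + 1) (n := 0) rfl, w0]
  -- the four relations around `u`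
  have c0 : (frameCoord u (F (cSrc (u, 0)))).re = (frameCoord u (F (cSrc (u, 1)))).re := by
    have hc := (projLine_cornerLine_eq_iff u u 0 (n := 0) rfl _ _).1 (h 0)
    rwa [show cTgt (u, 0) = cSrc (u, 1) from rfl, r0, s0] at hc
  have c1 : (frameCoord u (F (cSrc (u, 1)))).re - (frameCoord u (F (cSrc (u, 1)))).im =
      (frameCoord u (F (cSrc (u, 2)))).re - (frameCoord u (F (cSrc (u, 2)))).im := by
    have hc := (projLine_cornerLine_eq_iff u u 1 (n := 1) rfl _ _).1 (h 1)
    rwa [show cTgt (u, 1) = cSrc (u, 2) from rfl, s1, t1] at hc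
  have c2 : -2 * (frameCoord u (F (cSrc (u, 2)))).im = -2 * (frameCoord u (F (cSrc (u, 3)))).im := by
    have hc := (projLine_cornerLine_eq_iff u u 2 (n := 2) rfl _ _).1 (h 2)
    rwa [show cTgt (u, 2) = cSrc (u, 3) from rfl, t2, w2] at hc
  have c3 : -2 * (frameCoord u (F (cSrc (u, 3)))).re - 2 * (frameCoord u (F (cSrc (u, 3)))).im =
      -2 * (frameCoord u (F (cSrc (u, 0)))).re - 2 * (frameCoord u (F (cSrc (u, 0)))).im := by
    have hc := (projLine_cornerLine_eq_iff u u 3 (n := 3) rfl _ _).1 (h 3)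
    rwa [show cTgt (u, 3) = cSrc (u, 0) from rfl, w3, r3] at hc
  -- the right-hand side in the frame
  have hs : (Real.sqrt 2 : ℝ) ≠ 0 := (Real.sqrt_pos.2 two_pos).ne'
  have hn : ‖F (cSrc (u, 0)) - F (cSrc (u, 2))‖ ^ 2 =
      ((frameCoord u (F (cSrc (u, 0))) - frameCoord u (F (cSrc (u, 2)))).re ^ 2 +
        (frameCoord u (F (cSrc (u, 0))) - frameCoord u (F (cSrc (u, 2)))).im ^ 2) / Real.sqrt 2 := by
    rw [eq_div_iff hs, ← frameCoord_sub, ← norm_frameCoord_sq, Complex.sq_norm, normSq_apply]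
    ring
  rw [Fin.sum_univ_four, e0, e1, e2, e3, f0, f1, f2, f3, hn]
  simp only [sub_re, sub_im]
  set x₀ := (frameCoord u (F (cSrc (u, 0)))).re
  set y₀ := (frameCoord u (F (cSrc (u, 0)))).im
  set x₁ := (frameCoord u (F (cSrc (u, 1)))).re
  set y₁ := (frameCoord u (F (cSrc (u, 1)))).im
  set x₂ := (frameCoord u (F (cSrc (u, 2)))).re
  set y₂ := (frameCoord u (F (cSrc (u, 2)))).im
  set x₃ := (frameCoord u (F (cSrc (u, 3)))).re
  set y₃ := (frameCoord u (F (cSrc (u, 3)))).im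
  have key := appendixC_white_identity x₀ y₀ x₁ y₁ x₂ y₂ x₃ y₃ c0 c1 (by linarith) (by linarith)
  linear_combination (1 / Real.sqrt 2) * key

/-- **Lemma 3.8, black squares (faces): `H^b` is subharmonic.** At a face `f` of `ℤ²` (lower-left
corner `f`) with sides `E_j = cSrc (f + cornerOff j, j)` (bottom, right, top, left), the sum over
the four edge-adjacent faces `f'_j` (across `E_j`) of the increments
`H(f'_j) - H(f) = |F(f + cornerOff j, j + 3)|² - |F(f + cornerOff j, j)|²` equals
`+‖F(E₀) - F(E₂)‖²` (and `‖F(E₁) - F(E₃)‖²` by symmetry); in particular it is `≥ 0`: `Δ H^b ≥ 0`. Hypotheses: s-holomorphicity at the four corners `(f + cornerOff j, j)` of the face and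
at the four arriving corners `(f + cornerOff j, j + 3)` of the neighbouring faces (to read the outer
fluxes at `E_j`). Same frame computation as for the white squares. [cite: Smirnov2010, Lemma 3.8 and Appendix C] -/
theorem sum_faceStep_eq_norm_sq (F : MedialVertex → ℂ) (f : Site 2)
    (h : ∀ j : Fin 4, IsSHolAt F (f + cornerOff j, j)) (h' : ∀ j : Fin 4, IsSHolAt F (f + cornerOff j, j + 3)) :
    ∑ j : Fin 4, (cornerFlux F (f + cornerOff j, j + 3) - cornerFlux F (f + cornerOff j, j)) =
      ‖F (cSrc (f + cornerOff 0, 0)) - F (cSrc (f + cornerOff 2, 2))‖ ^ 2 := by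
  obtain ⟨r0, r1, -, r3⟩ := re_mul_one_add_I_pow (frameCoord f (F (cSrc (f + cornerOff 0, 0))))
  obtain ⟨s0, s1, s2, -⟩ := re_mul_one_add_I_pow (frameCoord f (F (cSrc (f + cornerOff 1, 1))))
  obtain ⟨-, t1, t2, t3⟩ := re_mul_one_add_I_pow (frameCoord f (F (cSrc (f + cornerOff 2, 2))))
  obtain ⟨w0, -, w2, w3⟩ := re_mul_one_add_I_pow (frameCoord f (F (cSrc (f + cornerOff 3, 3))))
  -- inner fluxes (corners of the face, lines `j`)
  have e0 : cornerFlux F (f + cornerOff 0, 0) =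
      (frameCoord f (F (cSrc (f + cornerOff 0, 0)))).re ^ 2 / (Real.sqrt 2 * 2 ^ 0) := by
    show ‖projLine (cornerLine (f + cornerOff 0) (faceAt (f + cornerOff 0) 0))
      (F (cSrc (f + cornerOff 0, 0)))‖ ^ 2 = _
    rw [norm_projLine_cornerLine_sq f _ 0 (n := 0) rfl, r0]
  have e1 : cornerFlux F (f + cornerOff 1, 1) = ((frameCoord f (F (cSrc (f + cornerOff 1, 1)))).re -
      (frameCoord f (F (cSrc (f + cornerOff 1, 1)))).im) ^ 2 / (Real.sqrt 2 * 2 ^ 1) := by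
    show ‖projLine (cornerLine (f + cornerOff 1) (faceAt (f + cornerOff 1) 1))
      (F (cSrc (f + cornerOff 1, 1)))‖ ^ 2 = _
    rw [norm_projLine_cornerLine_sq f _ 1 (n := 1) rfl, s1]
  have e2 : cornerFlux F (f + cornerOff 2, 2) = (-2 * (frameCoord f (F (cSrc (f + cornerOff 2, 2)))).im) ^ 2 /
      (Real.sqrt 2 * 2 ^ 2) := by
    show ‖projLine (cornerLine (f + cornerOff 2) (faceAt (f + cornerOff 2) 2))
      (F (cSrc (f + cornerOff 2, 2)))‖ ^ 2 = _
    rw [norm_projLine_cornerLine_sq f _ 2 (n := 2) rfl, t2]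
  have e3 : cornerFlux F (f + cornerOff 3, 3) = (-2 * (frameCoord f (F (cSrc (f + cornerOff 3, 3)))).re -
      2 * (frameCoord f (F (cSrc (f + cornerOff 3, 3)))).im) ^ 2 / (Real.sqrt 2 * 2 ^ 3) := by
    show ‖projLine (cornerLine (f + cornerOff 3) (faceAt (f + cornerOff 3) 3))
      (F (cSrc (f + cornerOff 3, 3)))‖ ^ 2 = _
    rw [norm_projLine_cornerLine_sq f _ 3 (n := 3) rfl, w3]
  -- outer fluxes (corners `(f + cornerOff j, j + 3)`, lines `j + 3`), read at `E_j` through `h'`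
  have f0 : cornerFlux F (f + cornerOff 0, 0 + 3) = (-2 * (frameCoord f (F (cSrc (f + cornerOff 0, 0)))).re -
      2 * (frameCoord f (F (cSrc (f + cornerOff 0, 0)))).im) ^ 2 / (Real.sqrt 2 * 2 ^ 3) := by
    rw [(h' 0).cornerFlux_eq, cTgt_add_three]
    show ‖projLine (cornerLine (f + cornerOff 0) (faceAt (f + cornerOff 0) (0 + 3)))
      (F (cSrc (f + cornerOff 0, 0)))‖ ^ 2 = _
    rw [norm_projLine_cornerLine_sq f _ (0 + 3) (n := 3) rfl, r3]
  have f1 : cornerFlux F (f + cornerOff 1, 1 + 3) =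
      (frameCoord f (F (cSrc (f + cornerOff 1, 1)))).re ^ 2 / (Real.sqrt 2 * 2 ^ 0) := by
    rw [(h' 1).cornerFlux_eq, cTgt_add_three]
    show ‖projLine (cornerLine (f + cornerOff 1) (faceAt (f + cornerOff 1) (1 + 3)))
      (F (cSrc (f + cornerOff 1, 1)))‖ ^ 2 = _
    rw [norm_projLine_cornerLine_sq f _ (1 + 3) (n := 0) rfl, s0]
  have f2 : cornerFlux F (f + cornerOff 2, 2 + 3) = ((frameCoord f (F (cSrc (f + cornerOff 2, 2)))).re -
      (frameCoord f (F (cSrc (f + cornerOff 2, 2)))).im) ^ 2 / (Real.sqrt 2 * 2 ^ 1) := by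
    rw [(h' 2).cornerFlux_eq, cTgt_add_three]
    show ‖projLine (cornerLine (f + cornerOff 2) (faceAt (f + cornerOff 2) (2 + 3)))
      (F (cSrc (f + cornerOff 2, 2)))‖ ^ 2 = _
    rw [norm_projLine_cornerLine_sq f _ (2 + 3) (n := 1) rfl, t1]
  have f3 : cornerFlux F (f + cornerOff 3, 3 + 3) = (-2 * (frameCoord f (F (cSrc (f + cornerOff 3, 3)))).im) ^ 2 /
      (Real.sqrt 2 * 2 ^ 2) := by
    rw [(h' 3).cornerFlux_eq, cTgt_add_three]
    show ‖projLine (cornerLine (f + cornerOff 3) (faceAt (f + cornerOff 3) (3 + 3)))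
      (F (cSrc (f + cornerOff 3, 3)))‖ ^ 2 = _
    rw [norm_projLine_cornerLine_sq f _ (3 + 3) (n := 2) rfl, w2]
  -- the four relations at the corners of the face (`E_j` and `E_{j+3}` project equally onto `ℓ_j`)
  have c0 : (frameCoord f (F (cSrc (f + cornerOff 0, 0)))).re =
      (frameCoord f (F (cSrc (f + cornerOff 3, 3)))).re := by
    have hc := (projLine_cornerLine_eq_iff f (f + cornerOff 0) 0 (n := 0) rfl _ _).1 (h 0)
    rwa [cTgt_face_corner f (j := 0) (i := 3) (by decide), r0, w0] at hc
  have c1 : (frameCoord f (F (cSrc (f + cornerOff 1, 1)))).re - (frameCoord f (F (cSrc (f + cornerOff 1, 1)))).im =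
      (frameCoord f (F (cSrc (f + cornerOff 0, 0)))).re - (frameCoord f (F (cSrc (f + cornerOff 0, 0)))).im := by
    have hc := (projLine_cornerLine_eq_iff f (f + cornerOff 1) 1 (n := 1) rfl _ _).1 (h 1)
    rwa [cTgt_face_corner f (j := 1) (i := 0) (by decide), s1, r1] at hc
  have c2 : -2 * (frameCoord f (F (cSrc (f + cornerOff 2, 2)))).im =
      -2 * (frameCoord f (F (cSrc (f + cornerOff 1, 1)))).im := by
    have hc := (projLine_cornerLine_eq_iff f (f + cornerOff 2) 2 (n := 2) rfl _ _).1 (h 2)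
    rwa [cTgt_face_corner f (j := 2) (i := 1) (by decide), t2, s2] at hc
  have c3 : -2 * (frameCoord f (F (cSrc (f + cornerOff 3, 3)))).re - 2 * (frameCoord f (F (cSrc (f + cornerOff 3, 3)))).im =
      -2 * (frameCoord f (F (cSrc (f + cornerOff 2, 2)))).re - 2 * (frameCoord f (F (cSrc (f + cornerOff 2, 2)))).im := by
    have hc := (projLine_cornerLine_eq_iff f (f + cornerOff 3) 3 (n := 3) rfl _ _).1 (h 3)
    rwa [cTgt_face_corner f (j := 3) (i := 2) (by decide), w3, t3] at hc
  -- the right-hand side in the frame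
  have hs : (Real.sqrt 2 : ℝ) ≠ 0 := (Real.sqrt_pos.2 two_pos).ne'
  have hn : ‖F (cSrc (f + cornerOff 0, 0)) - F (cSrc (f + cornerOff 2, 2))‖ ^ 2 =
      ((frameCoord f (F (cSrc (f + cornerOff 0, 0))) - frameCoord f (F (cSrc (f + cornerOff 2, 2)))).re ^ 2 +
        (frameCoord f (F (cSrc (f + cornerOff 0, 0))) - frameCoord f (F (cSrc (f + cornerOff 2, 2)))).im ^ 2) /
          Real.sqrt 2 := by
    rw [eq_div_iff hs, ← frameCoord_sub, ← norm_frameCoord_sq, Complex.sq_norm, normSq_apply]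
    ring
  rw [Fin.sum_univ_four, e0, e1, e2, e3, f0, f1, f2, f3, hn]
  simp only [sub_re, sub_im]
  set x₀ := (frameCoord f (F (cSrc (f + cornerOff 0, 0)))).re
  set y₀ := (frameCoord f (F (cSrc (f + cornerOff 0, 0)))).im
  set x₁ := (frameCoord f (F (cSrc (f + cornerOff 1, 1)))).re
  set y₁ := (frameCoord f (F (cSrc (f + cornerOff 1, 1)))).im
  set x₂ := (frameCoord f (F (cSrc (f + cornerOff 2, 2)))).re
  set y₂ := (frameCoord f (F (cSrc (f + cornerOff 2, 2)))).im
  set x₃ := (frameCoord f (F (cSrc (f + cornerOff 3, 3)))).re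
  set y₃ := (frameCoord f (F (cSrc (f + cornerOff 3, 3)))).im
  have key := appendixC_black_identity x₀ y₀ x₁ y₁ x₂ y₂ x₃ y₃ c0 c1 (by linarith) (by linarith)
  linear_combination (1 / Real.sqrt 2) * key

end Literature.Probability.LatticeModels
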